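import Mathlib
import Summits.KontsevichZagierPeriods.Zeta5Search.CellBridgeDischarge
import HarnessLib

/-!
# The cellular BRIDGE relation holds at EVERY convergent cluster (cell `pub-zeta5`, seat ct-1 g23)

HONEST FRAMING: systematic search; no irrationality claim unless certified.  Identities among Brown–Zudilin's absolutely convergent
cellular integrals `I(a)` (arXiv:2210.03391, (1), (8)/(10), (16)); no integral is evaluated, nothing about `ζ(5)`; no `def`, no node.

ct-1 g18's `CellBridgeDischarge.cellBridge_holds` proves the `@[conjecture]` node `CellBridge` — the four-term relation
`d_c·I(a) + d₇·I(a − s₇) + d_X·I(a + e₁ + e₃) + d_DS·I(a + DS) = 0` — at every cluster whose four members satisfy `RegionHyp`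
(the half box).  Its proof uses `RegionHyp` ONLY through the convergence of the four members (`isMoment_cellularIntegral_add`);
the translation step `bridge_translate` is already stated with convergence hypotheses.  This file records the relation at EVERY
cluster of four CONVERGENT members:

* `fourTerm_of_translates` — the moment step for FOUR convergent points and quadratic coefficient polynomials (as ct-1 g23's
  `CellStarWide.threeTerm_of_translates`, one more index);
* **`cellBridge_wide`** — `FourTermRel (bridgeBase c) (bridgeSlot c) (bridgeHalf c) (bridgeApex c) a (a − s₇) (a + e₁ + e₃) (a + DS)`,
  `c = b(a)`, whenever the four members converge.

Use: the cellular half of the BRIDGE steps (max slot raised) of the induction for the off-half-box residual of `wedgeDictionaryFull`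
(`HOME/ct-1/g22/WIDE-RESIDUAL.md` §5; ct-1 g23 plan, INBOX l.9031).
-/

noncomputable section

namespace Summit.KontsevichZagierPeriods.Zeta5Search.CellBridgeWide

open MeasureTheory Set Filter Finset
open Literature.NumberTheory.Irrationality.BrownZudilin2022
open Summit.KontsevichZagierPeriods.Zeta5Search.WedgeDictionary
open Summit.KontsevichZagierPeriods.Zeta5Search.MomentSequences
open Summit.KontsevichZagierPeriods.Zeta5Search.InvarianceGroup (isMoment_cellularIntegral_add)
open Summit.KontsevichZagierPeriods.Zeta5Search.CellBridgeDischarge (lincomb_eq_zero_of_eventually converges_translate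
  bridge_translate bridgeBase_translate bridgeSlot_translate bridgeHalf_translate bridgeApex_translate)

/-- **Four convergent points, quadratic coefficients**: if `Σ_m (A_m n² + B_m n + C_m)·I(x_m + n·𝟙) = 0` for all `n ≥ N₀`, then
`Σ_m C_m·I(x_m) = 0`.  Division by `(n+1)(n+2)(n+3)`, Lagrange interpolation at `−1, −2, −3`, and ct-1 g18's
`lincomb_eq_zero_of_eventually` for the twelve moment sequences `I(x_m + n·𝟙)/(n+i+1)`. [folklore] -/
theorem fourTerm_of_translates (x : Fin 4 → (Fin 8 → ℤ)) (hx : ∀ m, Converges (x m)) (A B C : Fin 4 → ℝ) {N₀ : ℕ}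
    (h : ∀ n : ℕ, N₀ ≤ n →
      ∑ m, (A m * (n : ℝ) ^ 2 + B m * (n : ℝ) + C m) * cellularIntegral (fun i => x m i + (n : ℤ)) = 0) :
    ∑ m, C m * cellularIntegral (x m) = 0 := by
  set M : Fin 4 → ℕ → ℝ := fun m n => cellularIntegral (fun i => x m i + (n : ℤ)) with hM
  have hMall : ∀ m : Fin 4, IsMoment (M m) := fun m => by
    simpa [hM] using isMoment_cellularIntegral_add (hx m)
  set u : Fin 3 → ℕ → ℝ := fun i n => ((n + (i : ℕ)).factorial : ℝ) / (n + ((i : ℕ) + 1)).factorial with hu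
  have huM : ∀ i : Fin 3, IsMoment (u i) := fun i => IsMoment.factorialRatio (by omega)
  have hu_eq : ∀ (i : Fin 3) (n : ℕ), u i n = 1 / ((n : ℝ) + (i : ℕ) + 1) := by
    intro i n
    simp only [hu]
    rw [show n + ((i : ℕ) + 1) = (n + (i : ℕ)) + 1 by ring, Nat.factorial_succ]
    have hf : ((n + (i : ℕ)).factorial : ℝ) ≠ 0 := by positivity
    push_cast
    field_simp
  set β : Fin 4 → ℝ → ℝ := fun m t => A m * t ^ 2 + B m * t + C m with hβ
  set L : Fin 3 → ℝ := ![1 / 2, -1, 1 / 2] with hL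
  set c : Fin 4 × Fin 3 → ℝ := fun ki => β ki.1 (-((ki.2 : ℕ) + 1 : ℝ)) * L ki.2 with hc
  set mm : Fin 4 × Fin 3 → ℕ → ℝ := fun ki n => u ki.2 n * M ki.1 n with hmm
  have hm_moment : ∀ ki ∈ (Finset.univ : Finset (Fin 4 × Fin 3)), IsMoment (mm ki) :=
    fun ki _ => (huM ki.2).mul (hMall ki.1)
  have key1 : ∀ (k : Fin 4) (n : ℕ),
      ∑ i : Fin 3, c (k, i) * u i n = β k n / (((n : ℝ) + 1) * ((n : ℝ) + 2) * ((n : ℝ) + 3)) := by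
    intro k n
    have h1 : ((n : ℝ) + 1) ≠ 0 := (by positivity); have h2 : ((n : ℝ) + 2) ≠ 0 := (by positivity)
    have h3 : ((n : ℝ) + 3) ≠ 0 := (by positivity); have h1' : ((n : ℝ) + 0 + 1) ≠ 0 := (by positivity)
    have h2' : ((n : ℝ) + 1 + 1) ≠ 0 := (by positivity); have h3' : ((n : ℝ) + 2 + 1) ≠ 0 := (by positivity)
    simp only [Fin.sum_univ_three, hc, hu_eq, hL, hβ, Matrix.cons_val, Fin.isValue, Fin.val_zero, Fin.val_one, Fin.val_two,
      Nat.cast_zero, Nat.cast_one, Nat.cast_ofNat]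
    field_simp
    ring
  have key : ∀ n : ℕ, ∑ ki, c ki * mm ki n =
      (∑ k, β k n * M k n) / (((n : ℝ) + 1) * ((n : ℝ) + 2) * ((n : ℝ) + 3)) := by
    intro n
    rw [Fintype.sum_prod_type, Finset.sum_div]
    refine Finset.sum_congr rfl fun k _ => ?_
    have hk : ∑ i : Fin 3, c (k, i) * mm (k, i) n = (∑ i : Fin 3, c (k, i) * u i n) * M k n := by
      rw [Finset.sum_mul]
      refine Finset.sum_congr rfl fun i _ => ?_
      simp only [hmm]
      ring
    rw [hk, key1 k n]
    ring
  have hnum : ∀ n : ℕ, N₀ ≤ n → ∑ k, β k n * M k n = 0 := by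
    intro n hn
    have h' := h n hn
    simpa [hβ, hM] using h'
  have hzero : ∀ n : ℕ, N₀ ≤ n → ∑ ki, c ki * mm ki n = 0 := by
    intro n hn
    rw [key n, hnum n hn, zero_div]
  have h0 := lincomb_eq_zero_of_eventually Finset.univ c mm hm_moment hzero
  rw [key 0, div_eq_zero_iff] at h0
  have hden : (((0 : ℕ) : ℝ) + 1) * (((0 : ℕ) : ℝ) + 2) * (((0 : ℕ) : ℝ) + 3) ≠ 0 := by norm_num
  have h00 : ∑ k, β k ((0 : ℕ) : ℝ) * M k 0 = 0 := h0.resolve_right hden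
  simp only [hβ, hM, Nat.cast_zero] at h00
  simpa using h00

/-- **The cellular BRIDGE relation at every convergent cluster**: if `a`, `a − s₇`, `a + e₁ + e₃`, `a + DS` converge, then
`d_c·I(a) + d₇·I(a − s₇) + d_X·I(a + e₁ + e₃) + d_DS·I(a + DS) = 0` with gen-1 g15's coefficients
`d_c = (N+1−c₇)(2N−c₁−c₂−c₃−c₆−c₇)`, `d₇ = −(N−c₃−c₇)(N−c₆−c₇)`, `d_X = (N+1−c₇)(N+1−c₁−c₆)`, `d_DS = (c₁+1)(c₆+1)`, `c = b(a)` —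
ct-1 g18's `bridge_translate` (native certificate at the translates) and `fourTerm_of_translates`; no half box. [folklore] -/
theorem cellBridge_wide (a : Fin 8 → ℤ) (hc0 : Converges a) (hc1 : Converges (a - slotDown 7)) (hc2 : Converges (a + halfUp457))
    (hc3 : Converges (a + dsUp)) :
    FourTermRel (bridgeBase (bOfA a)) (bridgeSlot (bOfA a)) (bridgeHalf (bOfA a)) (bridgeApex (bOfA a))
      a (a - slotDown 7) (a + halfUp457) (a + dsUp) := by
  have key := fourTerm_of_translates ![a, a - slotDown 7, a + halfUp457, a + dsUp]
    (by intro m; fin_cases m <;> assumption)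
    ![2, -1, 2, 1]
    ![2 * (2 * (bOfA a 0 : ℝ) - bOfA a 1 - bOfA a 2 - bOfA a 3 - bOfA a 6 - bOfA a 7) + ((bOfA a 0 : ℝ) + 1 - bOfA a 7),
      -(((bOfA a 0 : ℝ) - bOfA a 3 - bOfA a 7) + ((bOfA a 0 : ℝ) - bOfA a 6 - bOfA a 7)),
      2 * ((bOfA a 0 : ℝ) + 1 - bOfA a 1 - bOfA a 6) + ((bOfA a 0 : ℝ) + 1 - bOfA a 7),
      ((bOfA a 1 : ℝ) + 1) + ((bOfA a 6 : ℝ) + 1)]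
    ![((bOfA a 0 : ℝ) + 1 - bOfA a 7) * (2 * (bOfA a 0 : ℝ) - bOfA a 1 - bOfA a 2 - bOfA a 3 - bOfA a 6 - bOfA a 7),
      -(((bOfA a 0 : ℝ) - bOfA a 3 - bOfA a 7) * ((bOfA a 0 : ℝ) - bOfA a 6 - bOfA a 7)),
      ((bOfA a 0 : ℝ) + 1 - bOfA a 7) * ((bOfA a 0 : ℝ) + 1 - bOfA a 1 - bOfA a 6),
      ((bOfA a 1 : ℝ) + 1) * ((bOfA a 6 : ℝ) + 1)]
    (N₀ := 40 * (∑ j : Fin 8, (a j).natAbs) + 8 + ((hList a).map Int.natAbs).sum +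
      ((hList (a - slotDown 7)).map Int.natAbs).sum + ((hList (a + halfUp457)).map Int.natAbs).sum +
      ((hList (a + dsUp)).map Int.natAbs).sum)
    (by
      intro n hn
      have h := bridge_translate a n (by omega) (converges_translate (by omega)) (converges_translate (by omega))
        (converges_translate (by omega)) (converges_translate (by omega))
      rw [bridgeBase_translate, bridgeSlot_translate, bridgeHalf_translate, bridgeApex_translate] at h
      push_cast at h
      simp only [Fin.sum_univ_four, Matrix.cons_val_zero, Matrix.cons_val_one, Matrix.head_cons, Matrix.cons_val_two,
        Matrix.cons_val_three, Matrix.tail_cons]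
      linear_combination h)
  unfold FourTermRel
  simp only [Fin.sum_univ_four, Matrix.cons_val_zero, Matrix.cons_val_one, Matrix.head_cons, Matrix.cons_val_two,
    Matrix.cons_val_three, Matrix.tail_cons] at key
  simp only [bridgeBase, bridgeSlot, bridgeHalf, bridgeApex]
  push_cast
  linear_combination key

end Summit.KontsevichZagierPeriods.Zeta5Search.CellBridgeWide

end
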